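import Summits.Ventures.PercRepro.S2TopCountCell

/-!
# PercRepro — S2: THE RANK-`≤ 5` TAIL WITH THE FLAT SIZES PARAMETERS (p7, gen 13; sub-claim S2; the cell `(14, 8)`)

S2SpreadTail's `ncard_eRk_le_five_le_spread` (the rank part of the tail at `f = 8`, `f′ = 7`) generalised to parameters: on the `e`-free core of
rank `p` and corank `d ≥ 6` with every rank-`≤ 5` set of `≤ f` points and every rank-`≤ 4` set of `≤ f′` points (`7 ≤ f′ ≤ 4 + d`, the kit's
side conditions on the weights), **`ncard_eRk_le_five_le_flats`** bounds `#{ρ ≤ 5}` by the kit's quart counts at levels `4` and `5` with their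
σ-weights symbolic — in the case `k` of the nested dichotomy (`f = 5 + k`, `f′ = min 10 (4 + k)`) this is the concentrated tail's rank part
(`tailk.py`'s `tail_parts`), `137,568` against the kit's `162,061` at `(14, 8)`, `ν = 5`. Axioms: standard.
-/

open scoped Matroid

namespace PercRepro

namespace ThmN

open Set

variable {α : Type}

/-- **The rank-`≤ 5` tail with the flat sizes parameters** (`f` for the rank-`5` sets, `f′` for the rank-`4` sets; the kit's quart counts at
levels `4` and `5` with their σ-weights symbolic): `#{ρ ≤ 5} ≤ [C(n,4) + σ₄ₘ·val₄ + (σ₄g − σ₄ₘ)·C(min f′ (4 + d), 5)] + [8C(n,3) + 2C(n,2) + n + 1]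
+ [C(n,5) + σ₅ₘ·val₅ + (σ₅g − σ₅ₘ)·C(min f (5 + d), 6)]`. -/
theorem ncard_eRk_le_five_le_flats (M : Matroid α) [M.Finite] (p d : ℕ) (hd6 : 6 ≤ d)
    (hR : M.eRank = (p : ℕ∞)) (hn : M.E.ncard = p + d)
    (hfree : ∀ e ∈ M.E, ∃ A ⊆ M.E \ {e}, e ∉ M.closure A ∧ e ∉ M.closure ((M.E \ {e}) \ A))
    (f f' : ℕ) (hflat : ∀ X ⊆ M.E, M.eRk X ≤ 5 → X.ncard ≤ f)
    (hflat' : ∀ X ⊆ M.E, M.eRk X ≤ 4 → X.ncard ≤ f') (hf'7 : 7 ≤ f') (hf'd : f' ≤ 4 + d)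
    (hσm : f' - 5 ≤ min (f - 6) ((d + 6) / 2 + 1 - 2)) (hσg : min (f - 6) ((d + 6) / 2 + 1 - 2) ≤ min f (5 + d) - 6)
    (s3b s4b s5b : ℕ) (hs3 : {C : Set α | M.IsCircuit C ∧ C.ncard = 3}.ncard ≤ s3b)
    (hs4 : {C : Set α | M.IsCircuit C ∧ C.ncard = 4}.ncard ≤ s4b)
    (hs5 : {C : Set α | M.IsCircuit C ∧ C.ncard = 5}.ncard ≤ s5b) :
    ({X : Set α | X ⊆ M.E ∧ M.eRk X ≤ 5}.ncard : ℚ) ≤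
      (((p + d).choose 4 : ℚ) +
        (∑ j ∈ Finset.range (f' - 5 + 1), ((min (f' - 5) ((d + 3) / 2 + 1 - 2)).choose j : ℚ) / (((j + 1) + 3 * (j + 1).choose 2 + 3 * (j + 1).choose 3 + 2 * (j + 1).choose 4 : ℕ) : ℚ)) *
          ((s3b * (p + d - 3).choose 2 + s4b * (p + d - 4) + s5b : ℕ) : ℚ) +
        ((∑ j ∈ Finset.range (f' - 5 + 1), ((min f' (4 + d) - 5).choose j : ℚ) / (((j + 1) + 3 * (j + 1).choose 2 + 3 * (j + 1).choose 3 + 2 * (j + 1).choose 4 : ℕ) : ℚ)) -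
          (∑ j ∈ Finset.range (f' - 5 + 1), ((min (f' - 5) ((d + 3) / 2 + 1 - 2)).choose j : ℚ) / (((j + 1) + 3 * (j + 1).choose 2 + 3 * (j + 1).choose 3 + 2 * (j + 1).choose 4 : ℕ) : ℚ))) *
          ((min f' (4 + d)).choose 5 : ℚ)) +
      (((p + d).choose 3 * 2 ^ 3 + (p + d).choose 2 * 2 + (p + d) + 1 : ℕ) : ℚ) +
      (((p + d).choose 5 : ℚ) +
        (∑ j ∈ Finset.range (f - 6 + 1), ((min (f - 6) ((d + 6) / 2 + 1 - 2)).choose j : ℚ) / (((j + 1) + 3 * (j + 1).choose 2 + 3 * (j + 1).choose 3 + 2 * (j + 1).choose 4 : ℕ) : ℚ)) *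
          ((s3b * (p + d - 3).choose 3 + s4b * (p + d - 4).choose 2 + s5b * (p + d - 5) + (d + 5).choose 6 : ℕ) : ℚ) +
        ((∑ j ∈ Finset.range (f - 6 + 1), ((min f (5 + d) - 6).choose j : ℚ) / (((j + 1) + 3 * (j + 1).choose 2 + 3 * (j + 1).choose 3 + 2 * (j + 1).choose 4 : ℕ) : ℚ)) -
          (∑ j ∈ Finset.range (f - 6 + 1), ((min (f - 6) ((d + 6) / 2 + 1 - 2)).choose j : ℚ) / (((j + 1) + 3 * (j + 1).choose 2 + 3 * (j + 1).choose 3 + 2 * (j + 1).choose 4 : ℕ) : ℚ))) *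
          ((min f (5 + d)).choose 6 : ℚ)) := by
  classical
  -- the core is simple: every circuit has `≥ 3` elements
  have hL0 : ∀ e ∈ M.E, ¬ M.IsLoop e := not_isLoop_of_free M hfree
  have hs : ∀ e ∈ M.E, ∀ f ∈ M.E, e ≠ f → M.eRk {e, f} = 2 := by
    intro e he f hf hef
    have h2 : (2 : ℕ∞) ≤ M.eRk {e, f} :=
      two_le_eRk_of_two_le_ncard_of_free M hfree (pair_subset he hf) (by rw [ncard_pair hef])
    have h3 : M.eRk {e, f} ≤ 2 := by
      have := M.eRk_le_encard {e, f}
      rwa [encard_pair hef] at this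
    exact le_antisymm h3 h2
  have hcirc : ∀ C, M.IsCircuit C → 3 ≤ C.encard := three_le_encard_of_circuit M hL0 hs
  have hd : M.E.encard = M.eRank + d := by
    rw [hR, ← M.ground_finite.cast_ncard_eq, hn]
    push_cast
    ring
  have hC1 : ∀ L ⊆ M.E, M.eRk L = 2 → L.ncard ≤ 3 :=
    fun L hL hr => ncard_le_three_of_eRk_two M hs hfree hL hr
  have hC2 : ∀ P ⊆ M.E, M.eRk P ≤ 3 → P.ncard ≤ 6 :=
    fun P hP hr => ncard_le_six_of_eRk_le_three_of_free M hfree hP hr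
  have hs6 : {C | M.IsCircuit C ∧ C.ncard = 6}.ncard ≤ (d + 5).choose 6 :=
    Matroid.ncard_circuits_le_choose_of_encard M hd 5
  have hsum5 := S2.ncard_eRk_le_le_sum M 5
  simp only [Finset.sum_range_succ, Finset.sum_range_zero, zero_add] at hsum5
  -- the rank-`4` sets: `≤ f′` points each, the quart count at level `4` with `f := f′`, `f′ := 6`, `D = f′`
  have h4 : {X : Set α | X ⊆ M.E ∧ M.eRk X = 4}.ncard ≤
      {B : Set α | B ⊆ M.E ∧ M.eRk B = 4 ∧ B.ncard ≤ f'}.ncard := by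
    apply Set.ncard_le_ncard
    · intro X hX
      exact ⟨hX.1, hX.2, hflat' X hX.1 (by rw [hX.2])⟩
    · exact M.ground_finite.finite_subsets.subset (fun B hB => hB.1)
  have hinter4 : ∀ X ⊆ M.E, M.eRk X ≤ ((4 - 1 : ℕ) : ℕ∞) → (X.ncard : ℕ∞) ≤ M.eRk X + (3 : ℕ) := by
    intro X hX hr
    obtain ⟨k, hk⟩ := Matroid.exists_eRk_eq_nat (M := M) hX
    rw [hk] at hr ⊢
    have hk3 : k ≤ 3 := by exact_mod_cast hr
    have hcard : X.ncard ≤ k + 3 := by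
      rcases Nat.lt_or_ge k 3 with h | h
      · have := ncard_add_one_le_two_pow_of_eRk_le M hL0 hfree k X hX (le_of_eq hk)
        interval_cases k <;> omega
      · have hk' : k = 3 := by omega
        subst hk'
        have := hC2 X hX (le_of_eq hk)
        omega
    exact_mod_cast hcard
  set ν₄ : ℕ := (d + 3) / 2 + 1 with hν₄
  have hflat4' : ∀ X ⊆ M.E, M.eRk X ≤ ((4 - 1 : ℕ) : ℕ∞) → X.ncard ≤ 6 := fun X hX hr =>
    hC2 X hX (by simpa using hr)
  have hD4 := S2.ncard_eRk_eq_ncard_le_le_sets_quart M 4 f' 6 ν₄ 3 f' (by norm_num)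
    hcirc hC1 hC2 hflat' hflat4' hinter4 hd (by omega) (by omega) (by omega)
  rw [hn, sum_Icc_three_five_q] at hD4
  simp only [show (4 : ℕ) + 1 = 5 from rfl, show (5 : ℕ) - 3 = 2 from rfl, show (5 : ℕ) - 4 = 1 from rfl,
    show (5 : ℕ) - 5 = 0 from rfl, Nat.choose_one_right, Nat.choose_zero_right] at hD4
  have hsm4 : {C | M.IsCircuit C ∧ C.ncard = 3}.ncard * (p + d - 3).choose 2 +
      {C | M.IsCircuit C ∧ C.ncard = 4}.ncard * (p + d - 4) +
      {C | M.IsCircuit C ∧ C.ncard = 5}.ncard ≤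
      s3b * (p + d - 3).choose 2 + s4b * (p + d - 4) + s5b := by
    gcongr
  have hsm4q : (({C | M.IsCircuit C ∧ C.ncard = 3}.ncard : ℚ) * ((p + d - 3).choose 2 : ℚ) +
      ({C | M.IsCircuit C ∧ C.ncard = 4}.ncard : ℚ) * ((p + d - 4 : ℕ) : ℚ) +
      ({C | M.IsCircuit C ∧ C.ncard = 5}.ncard : ℚ)) ≤
      ((s3b * (p + d - 3).choose 2 + s4b * (p + d - 4) + s5b : ℕ) : ℚ) := by exact_mod_cast hsm4
  set σ4m : ℚ := ∑ j ∈ Finset.range (f' - 5 + 1), ((min (f' - 5) ((d + 3) / 2 + 1 - 2)).choose j : ℚ) / (((j + 1) + 3 * (j + 1).choose 2 + 3 * (j + 1).choose 3 + 2 * (j + 1).choose 4 : ℕ) : ℚ) with hσ4m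
  set σ4g : ℚ := ∑ j ∈ Finset.range (f' - 5 + 1), ((min f' (4 + d) - 5).choose j : ℚ) / (((j + 1) + 3 * (j + 1).choose 2 + 3 * (j + 1).choose 3 + 2 * (j + 1).choose 4 : ℕ) : ℚ) with hσ4g
  have hσ4m0 : (0 : ℚ) ≤ σ4m := Finset.sum_nonneg (fun j _ => by positivity)
  have hD4q : ({B : Set α | B ⊆ M.E ∧ M.eRk B = 4 ∧ B.ncard ≤ f'}.ncard : ℚ) ≤ ((p + d).choose 4 : ℚ) +
      σ4m * ((s3b * (p + d - 3).choose 2 + s4b * (p + d - 4) + s5b : ℕ) : ℚ) +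
      (σ4g - σ4m) * ((min f' (4 + d)).choose 5 : ℚ) := by
    refine hD4.trans ?_
    have e1 := mul_le_mul_of_nonneg_left hsm4q hσ4m0
    push_cast at e1 ⊢
    linarith
  -- the rank-`≤ 3` sets through their closures
  have h3 : {X : Set α | X ⊆ M.E ∧ M.eRk X = (3 : ℕ)}.ncard ≤ M.E.ncard.choose 3 * 2 ^ (6 - 3) :=
    S2.ncard_eRk_eq_le_choose_mul_two_pow M 3 6
      (fun X hX hr => ncard_le_six_of_eRk_le_three_of_free M hfree hX (by exact_mod_cast hr))
  have h2 : {X : Set α | X ⊆ M.E ∧ M.eRk X = (2 : ℕ)}.ncard ≤ M.E.ncard.choose 2 * 2 ^ (3 - 2) :=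
    S2.ncard_eRk_eq_le_choose_mul_two_pow M 2 3
      (fun X hX hr => by
        have := ncard_add_one_le_two_pow_of_eRk_le M hL0 hfree 2 X hX hr
        omega)
  have h1 : {X : Set α | X ⊆ M.E ∧ M.eRk X = (1 : ℕ)}.ncard ≤ M.E.ncard.choose 1 * 2 ^ (1 - 1) :=
    S2.ncard_eRk_eq_le_choose_mul_two_pow M 1 1
      (fun X hX hr => by
        have := ncard_add_one_le_two_pow_of_eRk_le M hL0 hfree 1 X hX hr
        omega)
  have h0 : {X : Set α | X ⊆ M.E ∧ M.eRk X = (0 : ℕ)}.ncard ≤ M.E.ncard.choose 0 * 2 ^ (0 - 0) :=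
    S2.ncard_eRk_eq_le_choose_mul_two_pow M 0 0
      (fun X hX hr => by
        have := ncard_add_one_le_two_pow_of_eRk_le M hL0 hfree 0 X hX hr
        omega)
  -- the rank-`5` sets: `≤ f` points each, the quart count at level `5` with `f`, `f′`, `D = f`
  have h5 : {X : Set α | X ⊆ M.E ∧ M.eRk X = 5}.ncard ≤
      {B : Set α | B ⊆ M.E ∧ M.eRk B = 5 ∧ B.ncard ≤ f}.ncard := by
    apply Set.ncard_le_ncard
    · intro X hX
      exact ⟨hX.1, hX.2, hflat X hX.1 (le_of_eq hX.2)⟩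
    · exact M.ground_finite.finite_subsets.subset (fun B hB => hB.1)
  set ν₁ : ℕ := (d + 6) / 2 + 1 with hν₁
  have hflat'' : ∀ X ⊆ M.E, M.eRk X ≤ ((5 - 1 : ℕ) : ℕ∞) → X.ncard ≤ f' := fun X hX hr =>
    hflat' X hX (by simpa using hr)
  have hD0 := S2.ncard_eRk_eq_ncard_le_le_sets_quart M 5 f f' ν₁ 6 f (by norm_num)
    hcirc hC1 hC2 hflat hflat'' (hinter_five M hfree) hd (by omega) hσm hσg
  rw [hn, sum_Icc_three_six_q] at hD0
  simp only [show (5 : ℕ) + 1 = 6 from rfl, show (6 : ℕ) - 3 = 3 from rfl, show (6 : ℕ) - 4 = 2 from rfl,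
    show (6 : ℕ) - 5 = 1 from rfl, show (6 : ℕ) - 6 = 0 from rfl, Nat.choose_one_right,
    Nat.choose_zero_right] at hD0
  have hsm : {C | M.IsCircuit C ∧ C.ncard = 3}.ncard * (p + d - 3).choose 3 +
      {C | M.IsCircuit C ∧ C.ncard = 4}.ncard * (p + d - 4).choose 2 +
      {C | M.IsCircuit C ∧ C.ncard = 5}.ncard * (p + d - 5) + {C | M.IsCircuit C ∧ C.ncard = 6}.ncard ≤
      s3b * (p + d - 3).choose 3 + s4b * (p + d - 4).choose 2 + s5b * (p + d - 5) + (d + 5).choose 6 := by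
    gcongr
  have hsmq : (({C | M.IsCircuit C ∧ C.ncard = 3}.ncard : ℚ) * ((p + d - 3).choose 3 : ℚ) +
      ({C | M.IsCircuit C ∧ C.ncard = 4}.ncard : ℚ) * ((p + d - 4).choose 2 : ℚ) +
      ({C | M.IsCircuit C ∧ C.ncard = 5}.ncard : ℚ) * ((p + d - 5 : ℕ) : ℚ) +
      ({C | M.IsCircuit C ∧ C.ncard = 6}.ncard : ℚ)) ≤
      ((s3b * (p + d - 3).choose 3 + s4b * (p + d - 4).choose 2 + s5b * (p + d - 5) + (d + 5).choose 6 : ℕ) : ℚ) := by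
    exact_mod_cast hsm
  set σ5m : ℚ := ∑ j ∈ Finset.range (f - 6 + 1), ((min (f - 6) ((d + 6) / 2 + 1 - 2)).choose j : ℚ) / (((j + 1) + 3 * (j + 1).choose 2 + 3 * (j + 1).choose 3 + 2 * (j + 1).choose 4 : ℕ) : ℚ) with hσ5m
  set σ5g : ℚ := ∑ j ∈ Finset.range (f - 6 + 1), ((min f (5 + d) - 6).choose j : ℚ) / (((j + 1) + 3 * (j + 1).choose 2 + 3 * (j + 1).choose 3 + 2 * (j + 1).choose 4 : ℕ) : ℚ) with hσ5g
  have hσ5m0 : (0 : ℚ) ≤ σ5m := Finset.sum_nonneg (fun j _ => by positivity)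
  have hDq : ({B : Set α | B ⊆ M.E ∧ M.eRk B = 5 ∧ B.ncard ≤ f}.ncard : ℚ) ≤ ((p + d).choose 5 : ℚ) +
      σ5m * ((s3b * (p + d - 3).choose 3 + s4b * (p + d - 4).choose 2 + s5b * (p + d - 5) + (d + 5).choose 6 : ℕ) : ℚ) +
      (σ5g - σ5m) * ((min f (5 + d)).choose 6 : ℚ) := by
    refine hD0.trans ?_
    have e1 := mul_le_mul_of_nonneg_left hsmq hσ5m0
    push_cast at e1 ⊢
    linarith
  -- assemble
  norm_num [Nat.choose_one_right] at h3 h2 h1 h0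
  rw [hn] at h3 h2 h1
  have hA4 : {X : Set α | X ⊆ M.E ∧ M.eRk X ≤ 5}.ncard ≤
      {B : Set α | B ⊆ M.E ∧ M.eRk B = 4 ∧ B.ncard ≤ f'}.ncard +
      ((p + d).choose 3 * 2 ^ 3 + (p + d).choose 2 * 2 + (p + d) + 1) +
      {B : Set α | B ⊆ M.E ∧ M.eRk B = 5 ∧ B.ncard ≤ f}.ncard := by
    push_cast at hsum5
    omega
  have hA4q : ({X : Set α | X ⊆ M.E ∧ M.eRk X ≤ 5}.ncard : ℚ) ≤
      ({B : Set α | B ⊆ M.E ∧ M.eRk B = 4 ∧ B.ncard ≤ f'}.ncard : ℚ) +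
      (((p + d).choose 3 * 2 ^ 3 + (p + d).choose 2 * 2 + (p + d) + 1 : ℕ) : ℚ) +
      ({B : Set α | B ⊆ M.E ∧ M.eRk B = 5 ∧ B.ncard ≤ f}.ncard : ℚ) := by exact_mod_cast hA4
  exact hA4q.trans (add_le_add (add_le_add hD4q le_rfl) hDq)

end ThmN

end PercRepro
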